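import Mathlib
import Literature.AlgebraicGeometry.Morphisms.CechModuleShortExact
import Literature.AlgebraicGeometry.Morphisms.CechModuleFiniteSupport
import Literature.AlgebraicGeometry.Modules.IdealMulMaps
import Literature.AlgebraicGeometry.Modules.AffineLocalizingClosure
import Literature.AlgebraicGeometry.Modules.IsoOfSectionsOnBasis
import HarnessLib

/-!
# Route `HomologicalConductor`, crux `NoZenoR` (stmt-ResolutionOfSingularities-19943; twin `NoZeno`
# stmt-16483), S3 G-layer, G1 = LEMMA L (sheaf half) — part 1/3: Čech `Ȟ¹` along an ideal filtration

OURS (cell res-hironaka, crux chain W4.4, seat res-L0-w44-stub-2). Nothing here is a statement of the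
manuscript under review (Hironaka 2017); AI-written, weaker than expert review.

For a family of affine opens `𝒰` of an `A`-scheme `f : X → Spec A` and an affine-localizing
(quasi-coherent) `𝒪_X`-module `F`:

* `cokernel_idealMulMono_app_eq_zero` — for ideal sheaves `I ≤ H` with `H·J = I`, the quotient
  `HF/IF` is supported on `V(J)` (its sections vanish on opens disjoint from `V(J)`);
* `cechMapH1_idealMulMono_surjective` — hence `Ȟ¹(𝒰, IF) → Ȟ¹(𝒰, HF)` is onto when `V(J)` is a
  finite set of closed points (`Morphisms/CechModuleFiniteSupport`);
* `cechMapH1_idealMulι_span_eq_zero` — **generator induction**: if `a_1, …, a_s ∈ A` all kill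
  `Ȟ¹(𝒰, F)` and `Ȟ¹(𝒰, ·)` is right exact on short exact sequences with affine-localizing kernel
  (hypothesis `hRE`; on a resolution of a surface singularity this is `H² = 0`, Görtz–Wedhorn II
  Cor. 24.44, tree `Morphisms.GortzWedhorn2023_24_44_H2.cechMapH1_surjective`), then the image of
  `Ȟ¹(𝒰, (a_1, …, a_s)F) → Ȟ¹(𝒰, F)` vanishes (`(a_1..a_k)F/(a_1..a_{k-1})F` is a quotient of `F` via
  `a_k •`, so its classes lift to `Ȟ¹(𝒰, F)`, where `a_k` acts by `0`).

These are the two homological steps of the chain's THEOREM Q-rat, Lemma A (A3) (res-L0-w44-idea-1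
`S3-structural-proof.md`, lead audit KERNEL-L0 §14), in a form that needs neither `H¹` of finitely
supported sheaves beyond the tree's Čech vanishing nor Mayer–Vietoris. Consumed by part 3/3
(`…NoZenoAnnihilatorLemmaL`). References: R. Hartshorne, *Algebraic Geometry* III.4 [`Hartshorne1977`];
The Stacks Project, Tag 01CL [`StacksProject`].
-/

noncomputable section

-- single-problem summit: the doubled namespace component `ResolutionOfSingularities` is forced
set_option linter.dupNamespace false

open CategoryTheory CategoryTheory.Limits AlgebraicGeometry TopologicalSpace Opposite IsLocalRing
open Literature.AlgebraicGeometry.Resolution Literature.AlgebraicGeometry.Morphisms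
open Literature.AlgebraicGeometry.Modules

namespace Summit.ResolutionOfSingularities.ResolutionOfSingularities.Theorems.NoZeno.SandwichCluster.LemmaL

universe u

/-! ## The quotient `HF/IF` for `I = H·J` is supported on `V(J)` -/

section Quotient

variable {X : Scheme.{u}}

/-- On an affine open disjoint from `V(J)`, the ideal `J(V)` is the unit ideal. [folklore] -/
theorem ideal_eq_top_of_disjoint_support (J : X.IdealSheafData) {V : X.Opens} (hV : IsAffineOpen V)
    (hW : Disjoint (V : Set X) (J.support : Set X)) : J.ideal ⟨V, hV⟩ = ⊤ := by
  have h1 : X.zeroLocus (U := V) (J.ideal ⟨V, hV⟩ : Set Γ(X, V)) ∩ V = ∅ := by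
    rw [← Scheme.IdealSheafData.coe_support_inter J ⟨V, hV⟩]
    exact Set.disjoint_iff_inter_eq_empty.mp hW.symm
  have h2 := hV.fromSpec_image_zeroLocus (J.ideal ⟨V, hV⟩ : Set Γ(X, V))
  rw [h1, Set.image_eq_empty] at h2
  exact PrimeSpectrum.zeroLocus_empty_iff_eq_top.mp h2

/-- For ideal sheaves `I ≤ H` with `H·J = I`, on an affine open disjoint from `V(J)` one has
`I(V) = H(V)`. [folklore] -/
theorem ideal_eq_ideal_of_disjoint_support {I H J : X.IdealSheafData} (hHJ : H * J = I)
    {V : X.Opens} (hV : IsAffineOpen V) (hW : Disjoint (V : Set X) (J.support : Set X)) :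
    I.ideal ⟨V, hV⟩ = H.ideal ⟨V, hV⟩ := by
  rw [← hHJ, Scheme.IdealSheafData.ideal_mul, Pi.mul_apply, ideal_eq_top_of_disjoint_support J hV hW,
    Ideal.mul_top]

/-- **The quotient `HF/IF` is supported on `V(J)`** (`I ≤ H`, `H·J = I`, `F` affine-localizing):
its sections over any open disjoint from `V(J)` vanish. [folklore] -/
theorem cokernel_idealMulMono_app_eq_zero (F : X.Modules) (hF : IsAffineLocalizing F)
    {I H J : X.IdealSheafData} (hHJ : H * J = I) (hIH : I ≤ H) (W : X.Opens)
    (hW : Disjoint (W : Set X) (J.support : Set X))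
    (s : Γ(cokernel (idealMulMono F hIH), W)) : s = 0 := by
  refine section_eq_zero_of_locally _ s fun x hx => ?_
  -- lift `s` locally through the epimorphism `HF → HF/IF`
  obtain ⟨V, hVW, hxV, m, hm⟩ :=
    Literature.AlgebraicGeometry.Motives.Scheme.Modules.exists_app_eq_of_epi
      (cokernel.π (idealMulMono F hIH)) W s x hx
  obtain ⟨V', hV', hxV', hV'V⟩ := Opens.isBasis_iff_nbhd.mp X.isBasis_affineOpens hxV
  refine ⟨V', hV'V.trans hVW, hxV', ?_⟩
  -- on the affine `V' ⊆ W`, `H(V') = I(V')`, so `m|_{V'}` is a section of `IF`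
  have hdisj : Disjoint ((V' : X.Opens) : Set X) (J.support : Set X) :=
    Set.disjoint_of_subset_left (fun y hy => hVW (hV'V hy)) hW
  set m' : Γ(idealMul F H, V') := (idealMul F H).presheaf.map (homOfLE hV'V).op m with hm'
  have hmem : (idealMulι F H).app V' m' ∈ I.ideal ⟨V', hV'⟩ • (⊤ : Submodule Γ(X, V') Γ(F, V')) := by
    rw [ideal_eq_ideal_of_disjoint_support hHJ hV' hdisj]
    exact idealMulι_app_mem hF hV' m'
  obtain ⟨n, hn⟩ := exists_idealMulι_app_eq F I _ (isIdealMulSection_of_mem hV' hmem)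
  -- `n : Γ(IF, V')` maps to `m'` under `IF → HF` (injectivity of `HF → F` on sections)
  have hnm : (idealMulMono F hIH).app V' n = m' := by
    apply idealMulι_app_injective F H V'
    rw [idealMulι_app_idealMulMono_app, hn]
  -- hence `s|_{V'} = π(m|_{V'}) = π(ι n) = 0`
  have e : (cokernel (idealMulMono F hIH)).presheaf.map (homOfLE (hV'V.trans hVW)).op s =
      (cokernel.π (idealMulMono F hIH)).app V' m' := by
    rw [map_eq_map (cokernel (idealMulMono F hIH)) (homOfLE (hV'V.trans hVW)).op
        ((homOfLE hVW).op ≫ (homOfLE hV'V).op) s, ← map_map, ← hm,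
      ← Literature.AlgebraicGeometry.Motives.Scheme.Modules.Hom.app_map_apply]
  rw [e, ← hnm]
  exact app_app_eq_zero (ShortComplex.mk (idealMulMono F hIH) (cokernel.π (idealMulMono F hIH))
    (cokernel.condition _)) V' n

end Quotient

/-! ## Čech consequences on an `A`-scheme -/

section Cech

variable {A : Type u} [CommRing A] {X : Scheme.{u}} (f : X ⟶ Spec (.of A)) (F : X.Modules)
  {ι : Type u} (U : ι → X.Opens)

/-- The short exact sequence `0 → IF → HF → HF/IF → 0` for `I ≤ H`. [folklore] -/
theorem shortExact_idealMulMono {I H : X.IdealSheafData} (hIH : I ≤ H) :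
    (ShortComplex.mk (idealMulMono F hIH) (cokernel.π (idealMulMono F hIH))
      (cokernel.condition _)).ShortExact :=
  ShortComplex.ShortExact.mk' (ShortComplex.exact_cokernel (idealMulMono F hIH))
    (mono_idealMulMono F hIH) (by dsimp only; infer_instance)

/-- **`Ȟ¹(IF) → Ȟ¹(HF)` is onto when `HF/IF` is supported on finitely many closed points**
(`I ≤ H`, `H·J = I`, `V(J)` a finite set of closed points, `F` affine-localizing, `U_i` affine).
[folklore] -/
theorem cechMapH1_idealMulMono_surjective (hF : IsAffineLocalizing F) {I H J : X.IdealSheafData}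
    (hHJ : H * J = I) (hIH : I ≤ H) (hJfin : (J.support : Set X).Finite)
    (hJcl : ∀ p ∈ (J.support : Set X), IsClosed ({p} : Set X)) (hU : ∀ i, IsAffineOpen (U i)) :
    Function.Surjective (cechMapH1 f (idealMulMono F hIH) U) := by
  intro y
  have hdata := CechExactData.of_shortExact f U (shortExact_idealMulMono F hIH)
    (isAffineLocalizing_idealMul (J := I) hF) hU
  refine hdata.exists_cechMapH1_eq y ?_
  exact CechMH1.eq_zero_of_finite_support f _ U hJfin hJcl
    (fun W hW s => cokernel_idealMulMono_app_eq_zero F hF hHJ hIH W hW s) _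

/-- Sections of `𝒥F` for `𝒥 = 0·𝒪_X` vanish. [folklore] -/
theorem idealMul_section_eq_zero_of_ideal_eq_bot {J : X.IdealSheafData}
    (hJ : ∀ V : X.affineOpens, J.ideal V = ⊥) (W : X.Opens) (t : Γ(idealMul F J, W)) : t = 0 := by
  apply idealMulι_app_injective F J W
  have h0 : (idealMulι F J).app W (0 : Γ(idealMul F J, W)) = 0 := map_zero _
  rw [h0]
  refine section_eq_zero_of_locally F _ fun x hx => ?_
  obtain ⟨V, hVW, hxV, hmem⟩ := isIdealMulSection_idealMulι_app F J W t x hx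
  refine ⟨V, hVW, hxV, ?_⟩
  rw [hJ V, Submodule.bot_smul, Submodule.mem_bot] at hmem
  exact hmem

/-- Sections of `globalScalarLift`: multiplication by the global function. [folklore] -/
theorem idealMulι_app_globalScalarLift_app {J : X.IdealSheafData} (g : Γ(X, ⊤))
    (hg : ∀ V : X.affineOpens, X.presheaf.map (homOfLE (le_top : (V : X.Opens) ≤ ⊤)).op g ∈ J.ideal V)
    (V : X.Opens) (m : Γ(F, V)) :
    (idealMulι F J).app V ((globalScalarLift F J g hg).app V m) =
      X.presheaf.map (homOfLE (le_top : V ≤ ⊤)).op g • m :=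
  rfl

/-- **`F → I₁F → I₁F/I₀F` is onto on affine opens** when `I₁ = g·𝒪_X + I₀` and the first map is
multiplication by `g` (`F` affine-localizing): `Γ(V, I₁F) = g·Γ(V, F) + Γ(V, I₀F)`. [folklore] -/
theorem globalScalarLift_comp_cokernel_app_surjective (hF : IsAffineLocalizing F)
    {I₀ I₁ : X.IdealSheafData} (h01 : I₀ ≤ I₁) (g : Γ(X, ⊤))
    (hg : ∀ V : X.affineOpens, X.presheaf.map (homOfLE (le_top : (V : X.Opens) ≤ ⊤)).op g ∈ I₁.ideal V)
    (hsplit : ∀ V : X.affineOpens, I₁.ideal V =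
      Ideal.span {X.presheaf.map (homOfLE (le_top : (V : X.Opens) ≤ ⊤)).op g} ⊔ I₀.ideal V)
    {V : X.Opens} (hV : IsAffineOpen V) :
    Function.Surjective
      ((globalScalarLift F I₁ g hg ≫ cokernel.π (idealMulMono F h01)).app V) := by
  intro z
  have hF0 : IsAffineLocalizing (idealMul F I₀) := isAffineLocalizing_idealMul (J := I₀) hF
  obtain ⟨m, rfl⟩ := app_surjective_of_shortExact (shortExact_idealMulMono F h01) hF0 hV z
  change ∃ u, (cokernel.π (idealMulMono F h01)).app V ((globalScalarLift F I₁ g hg).app V u) =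
    (cokernel.π (idealMulMono F h01)).app V m
  have hjq : ∀ w : Γ(idealMul F I₀, V),
      (cokernel.π (idealMulMono F h01)).app V ((idealMulMono F h01).app V w) = 0 := fun w =>
    app_app_eq_zero (ShortComplex.mk (idealMulMono F h01) (cokernel.π (idealMulMono F h01))
      (cokernel.condition _)) V w
  -- decompose `ι m ∈ I₁(V)·Γ(F,V) = g Γ(F,V) + I₀(V) Γ(F,V)`
  have hm := idealMulι_app_mem hF hV m
  rw [hsplit ⟨V, hV⟩, Submodule.sup_smul, Submodule.mem_sup] at hm
  obtain ⟨u, hu, w, hw, huw⟩ := hm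
  rw [Submodule.ideal_span_singleton_smul, Submodule.mem_smul_pointwise_iff_exists] at hu
  obtain ⟨u', -, rfl⟩ := hu
  obtain ⟨w', hw'⟩ := exists_idealMulι_app_eq F I₀ w (isIdealMulSection_of_mem hV hw)
  refine ⟨u' + (idealMulι F I₀).app V w', ?_⟩
  -- `σ (ι₀ w') = j (g • w')` dies in the quotient
  have h2 : (globalScalarLift F I₁ g hg).app V ((idealMulι F I₀).app V w') =
      (idealMulMono F h01).app V (X.presheaf.map (homOfLE (le_top : V ≤ ⊤)).op g • w') := by
    apply idealMulι_app_injective F I₁ V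
    rw [idealMulι_app_globalScalarLift_app, Scheme.Modules.Hom.app_smul, Scheme.Modules.Hom.app_smul,
      idealMulι_app_idealMulMono_app]
  -- `ι₁ (σ u' + j w') = g • u' + w = ι₁ m`
  have h1 : (globalScalarLift F I₁ g hg).app V u' + (idealMulMono F h01).app V w' = m := by
    apply idealMulι_app_injective F I₁ V
    rw [map_add, idealMulι_app_globalScalarLift_app, idealMulι_app_idealMulMono_app, hw', huw]
  rw [map_add, h2, map_add, hjq, add_zero, ← h1, map_add, hjq, add_zero]

/-- **One step of the generator induction**: for ideal sheaves `I₀ ≤ I₁ = a·𝒪_X + I₀` with `a ∈ A`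
killing `Ȟ¹(𝒰, F)`, if `Ȟ¹(I₀F) → Ȟ¹(F)` vanishes then so does `Ȟ¹(I₁F) → Ȟ¹(F)` (right exactness of
`Ȟ¹(𝒰, ·)` lifts classes of `Ȟ¹(I₁F/I₀F)` to `Ȟ¹(F)` along `a• : F ↠ I₁F/I₀F`). [folklore] -/
theorem cechMapH1_idealMulι_eq_zero_step (hF : IsAffineLocalizing F) (hU : ∀ i, IsAffineOpen (U i))
    (hRE : ∀ S : ShortComplex X.Modules, S.ShortExact → IsAffineLocalizing S.X₁ →
      Function.Surjective (cechMapH1 f S.g U))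
    {I₀ I₁ : X.IdealSheafData} (h01 : I₀ ≤ I₁) (a : A)
    (ha1 : ∀ V : X.affineOpens,
      X.presheaf.map (homOfLE (le_top : (V : X.Opens) ≤ ⊤)).op (algebraMapΓ f a) ∈ I₁.ideal V)
    (hsplit : ∀ V : X.affineOpens, I₁.ideal V =
      Ideal.span {X.presheaf.map (homOfLE (le_top : (V : X.Opens) ≤ ⊤)).op (algebraMapΓ f a)} ⊔
        I₀.ideal V)
    (ha : ∀ x : CechMH1 f F U, a • x = 0)
    (ih : ∀ y₀ : CechMH1 f (idealMul F I₀) U, cechMapH1 f (idealMulι F I₀) U y₀ = 0)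
    (y : CechMH1 f (idealMul F I₁) U) : cechMapH1 f (idealMulι F I₁) U y = 0 := by
  have hF0 : IsAffineLocalizing (idealMul F I₀) := isAffineLocalizing_idealMul (J := I₀) hF
  have hF1 : IsAffineLocalizing (idealMul F I₁) := isAffineLocalizing_idealMul (J := I₁) hF
  have hSESj := shortExact_idealMulMono F h01
  have hQ : IsAffineLocalizing (cokernel (idealMulMono F h01)) :=
    IsAffineLocalizing.of_shortExact₃ hSESj hF0 hF1
  have hdata : CechExactData f U (idealMulMono F h01) (cokernel.π (idealMulMono F h01)) :=
    CechExactData.of_shortExact f U hSESj hF0 hU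
  -- `σ : F → I₁F`, multiplication by `a`: `σ ≫ ι₁ = a•` and `σ ≫ q` is an epimorphism
  obtain ⟨σ, hσι, hepi⟩ : ∃ σ : F ⟶ idealMul F I₁,
      σ ≫ idealMulι F I₁ = globalScalar F (algebraMapΓ f a) ∧
        Epi (σ ≫ cokernel.π (idealMulMono F h01)) :=
    ⟨globalScalarLift F I₁ (algebraMapΓ f a) ha1, globalScalarLift_ι F I₁ (algebraMapΓ f a) ha1,
      epi_of_surjective_app_of_isAffineOpen _ fun V hV =>
        globalScalarLift_comp_cokernel_app_surjective F hF h01 (algebraMapΓ f a) ha1 hsplit hV⟩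
  -- the short exact sequence `0 → K → F → I₁F/I₀F → 0` and right exactness
  have hSES : (ShortComplex.mk (kernel.ι (σ ≫ cokernel.π (idealMulMono F h01)))
      (σ ≫ cokernel.π (idealMulMono F h01)) (kernel.condition _)).ShortExact :=
    ShortComplex.ShortExact.mk' (ShortComplex.exact_kernel _) (by dsimp only; infer_instance) hepi
  have hK : IsAffineLocalizing (kernel (σ ≫ cokernel.π (idealMulMono F h01))) :=
    IsAffineLocalizing.kernel _ hF hQ
  have hRE' := hRE _ hSES hK
  -- chase: `q y` lifts to `Ȟ¹(F)`; the difference comes from `Ȟ¹(I₀F)`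
  obtain ⟨z, hz⟩ := hRE' (cechMapH1 f (cokernel.π (idealMulMono F h01)) U y)
  have hz' : cechMapH1 f (cokernel.π (idealMulMono F h01)) U (cechMapH1 f σ U z) =
      cechMapH1 f (cokernel.π (idealMulMono F h01)) U y := by
    rw [← cechMapH1_comp]; exact hz
  obtain ⟨y₀, hy₀⟩ := hdata.exists_cechMapH1_eq (y - cechMapH1 f σ U z) (by
    rw [LinearMap.map_sub, hz', sub_self])
  -- apply `ι₁`: `ι₁ y = ι₁ σ z + ι₁ j y₀ = a • z + ι₀ y₀ = 0 + 0`
  have e : y = cechMapH1 f σ U z + cechMapH1 f (idealMulMono F h01) U y₀ := by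
    rw [hy₀]; abel
  rw [e, LinearMap.map_add, ← cechMapH1_comp, ← cechMapH1_comp, hσι, idealMulMono_ι,
    cechMapH1_globalScalar_algebraMapΓ, ha, zero_add]
  exact ih y₀

/-- **Generator induction**: if every `a ∈ s` (a finite set of elements of `A`) kills `Ȟ¹(𝒰, F)`,
then the image of `Ȟ¹(𝒰, 𝔟F) → Ȟ¹(𝒰, F)` vanishes for `𝔟 = (s)·𝒪_X`, granted right exactness of
`Ȟ¹(𝒰, ·)` on short exact sequences with affine-localizing kernel. [folklore] -/
theorem cechMapH1_idealMulι_span_eq_zero (hF : IsAffineLocalizing F) (hU : ∀ i, IsAffineOpen (U i))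
    (hRE : ∀ S : ShortComplex X.Modules, S.ShortExact → IsAffineLocalizing S.X₁ →
      Function.Surjective (cechMapH1 f S.g U))
    (s : Finset A) (hs : ∀ a ∈ s, ∀ x : CechMH1 f F U, a • x = 0) :
    ∀ y : CechMH1 f (idealMul F (Scheme.IdealSheafData.ofIdealTop
      (Ideal.span ((algebraMapΓ f) '' (s : Set A))))) U,
    cechMapH1 f (idealMulι F _) U y = 0 := by
  classical
  induction s using Finset.induction_on with
  | empty =>
    intro y
    -- `𝔟 = 0`: every section of `0·F` vanishes, so `Ȟ¹ = 0`
    have hJ : ∀ V : X.affineOpens, (Scheme.IdealSheafData.ofIdealTop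
        (Ideal.span ((algebraMapΓ f) '' ((∅ : Finset A) : Set A)))).ideal V = ⊥ := by
      intro V
      rw [Scheme.IdealSheafData.ofIdealTop_ideal, Finset.coe_empty, Set.image_empty,
        Ideal.span_empty, Ideal.map_bot]
    have hy : y = 0 :=
      CechMH1.eq_zero_of_finite_support f _ U Set.finite_empty (fun p hp => hp.elim)
        (fun W _ t => idealMul_section_eq_zero_of_ideal_eq_bot F hJ W t) y
    rw [hy, map_zero]
  | insert a s has ih =>
    -- `I₀ = (s)𝒪_X ≤ I₁ = (s ∪ {a})𝒪_X = a·𝒪_X + I₀`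
    have h01 : Scheme.IdealSheafData.ofIdealTop (Ideal.span ((algebraMapΓ f) '' (s : Set A))) ≤
        Scheme.IdealSheafData.ofIdealTop
          (Ideal.span ((algebraMapΓ f) '' ((insert a s : Finset A) : Set A))) := by
      refine Scheme.IdealSheafData.le_def.mpr fun V => ?_
      rw [Scheme.IdealSheafData.ofIdealTop_ideal, Scheme.IdealSheafData.ofIdealTop_ideal]
      exact Ideal.map_mono (Ideal.span_mono (Set.image_mono (by simp)))
    have ha1 : ∀ V : X.affineOpens,
        X.presheaf.map (homOfLE (le_top : (V : X.Opens) ≤ ⊤)).op (algebraMapΓ f a) ∈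
          (Scheme.IdealSheafData.ofIdealTop
            (Ideal.span ((algebraMapΓ f) '' ((insert a s : Finset A) : Set A)))).ideal V := by
      intro V
      rw [Scheme.IdealSheafData.ofIdealTop_ideal]
      exact Ideal.mem_map_of_mem _ (Ideal.subset_span ⟨a, by simp, rfl⟩)
    have hsplit : ∀ V : X.affineOpens, (Scheme.IdealSheafData.ofIdealTop
        (Ideal.span ((algebraMapΓ f) '' ((insert a s : Finset A) : Set A)))).ideal V =
          Ideal.span {X.presheaf.map (homOfLE (le_top : (V : X.Opens) ≤ ⊤)).op (algebraMapΓ f a)} ⊔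
            (Scheme.IdealSheafData.ofIdealTop (Ideal.span ((algebraMapΓ f) '' (s : Set A)))).ideal V := by
      intro V
      rw [Scheme.IdealSheafData.ofIdealTop_ideal, Scheme.IdealSheafData.ofIdealTop_ideal,
        Finset.coe_insert, Set.image_insert_eq, Ideal.span_insert, Ideal.map_sup, Ideal.map_span,
        Set.image_singleton]
    exact cechMapH1_idealMulι_eq_zero_step f F U hF hU hRE h01 a ha1 hsplit
      (hs a (Finset.mem_insert_self a s)) (ih fun b hb => hs b (Finset.mem_insert_of_mem hb))

end Cech

end Summit.ResolutionOfSingularities.ResolutionOfSingularities.Theorems.NoZeno.SandwichCluster.LemmaL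

end
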